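import Summits.PneNP.PneNP.Theorems.ChebyshevTracialDesignJuntaMatchingFiber
import Summits.PneNP.PneNP.Theorems.ChebyshevTracialDesignJuntaPatternLaw
import HarnessLib

/-!
# Junta virtual positivity, part E₂: matching-side pattern polynomial and junta sum law

Support file for the crux `TracialDecayExp20` (stmt-PneNP-19878) of route `ChebyshevTracialDesign`
(cell pnp-psdrank, local virtual positivity (N1), MATCHING-SIDE twin; builds on parts A, B, D, E₁).

* `pattern_poly_exists_pm`: `[a]_y · 2^z[i]_z · 2^e[i']_e / ([t]_{y+2z}[s]_{y+2e}) = P(a)` along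
  `a + 2i = t`, `a + 2i' = s`, for the real polynomial `P = [X]_y ∏_{j<z}(t-2j-X) ∏_{j<e}(s-2j-X)/([t]_{y+2z}[s]_{y+2e})`
  of degree `≤ x = y+z+e` with `P(0) ≥ 0`.
* `junta_sum_law_pm`: for a function `G` of perfect matchings of `S` depending only on the window edges
  `M[A]` (nonnegative values), the level sums `Σ_{M : #cr(U,M) = a} G(M)` equal `#{M : #cr = a} · P(a)`
  for one polynomial `P` of degree `≤ |A|` with `P(0) ≥ 0`.

No definitions; notation as in parts A/D.
-/

set_option linter.dupNamespace false -- `Summit.PneNP.PneNP.…`: summit = sub-problem (D-0017)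

namespace Summit.PneNP.PneNP.Theorems.ChebyshevTracialDesignJunta

open Finset Literature.Barriers.PneNP Literature.Combinatorics.SimpleGraph.CycleSpace

variable {V : Type*} [DecidableEq V]

section MatchingLaw

open Polynomial

/-- **Matching-side pattern polynomial**: for `x = y + z + e` window edges (`y` crossing, `z` inside the cut of
size `t`, `e` inside the complement of size `s`; `y + 2z ≤ t`, `y + 2e ≤ s`) there
is a real polynomial `P` of degree `≤ x` with `P(0) ≥ 0` and
`P(a)·[t]_{y+2z}·[s]_{y+2e} = [a]_y · 2^z[i]_z · 2^e[i']_e` whenever `a + 2i = t`, `a + 2i' = s`. Explicitly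
`P = [X]_y ∏_{j<z}(t - 2j - X) ∏_{j<e}(s - 2j - X) / ([t]_{y+2z}[s]_{y+2e})`. [folklore] -/
theorem pattern_poly_exists_pm (t s : ℕ) {x y z ee : ℕ} (hx : y + z + ee = x) (h1 : y + 2 * z ≤ t)
    (h2 : y + 2 * ee ≤ s) :
    ∃ P : Polynomial ℝ, P.natDegree ≤ x ∧ 0 ≤ P.eval 0 ∧
      ∀ a i i' : ℕ, a + 2 * i = t → a + 2 * i' = s →
        P.eval (a : ℝ) * (((t.descFactorial (y + 2 * z) : ℕ) : ℝ) * ((s.descFactorial (y + 2 * ee) : ℕ) : ℝ)) =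
          ((a.descFactorial y * (2 ^ z * i.descFactorial z) * (2 ^ ee * i'.descFactorial ee) : ℕ) : ℝ) := by
  have hD1 : 0 < (t.descFactorial (y + 2 * z) : ℝ) := by
    have : t.descFactorial (y + 2 * z) ≠ 0 := fun h0 => by
      rw [Nat.descFactorial_eq_zero_iff_lt] at h0; omega
    positivity
  have hD2 : 0 < (s.descFactorial (y + 2 * ee) : ℝ) := by
    have : s.descFactorial (y + 2 * ee) ≠ 0 := fun h0 => by
      rw [Nat.descFactorial_eq_zero_iff_lt] at h0; omega
    positivity
  set κ : ℝ := ((t.descFactorial (y + 2 * z) : ℝ) * (s.descFactorial (y + 2 * ee) : ℝ))⁻¹ with hκ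
  have hκ0 : 0 ≤ κ := by rw [hκ]; positivity
  have hlin : ∀ c : ℝ, (C c - X : Polynomial ℝ).natDegree ≤ 1 := fun c =>
    (natDegree_sub_le _ _).trans (max_le (by simp) natDegree_X_le)
  refine ⟨C κ * (∏ j ∈ range y, (X - C (j : ℝ))) * (∏ j ∈ range z, (C ((t : ℝ) - 2 * j) - X)) *
      ∏ j ∈ range ee, (C ((s : ℝ) - 2 * j) - X), ?_, ?_, ?_⟩
  · have hy : (∏ j ∈ range y, (X - C (j : ℝ))).natDegree ≤ y := by
      refine (natDegree_prod_le _ _).trans ?_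
      refine (sum_le_sum fun (j : ℕ) _ => (natDegree_X_sub_C ((j : ℕ) : ℝ)).le).trans ?_
      simp
    have hz : (∏ j ∈ range z, (C ((t : ℝ) - 2 * j) - X)).natDegree ≤ z := by
      refine (natDegree_prod_le _ _).trans ((sum_le_sum fun j _ => hlin _).trans ?_); simp
    have he : (∏ j ∈ range ee, (C ((s : ℝ) - 2 * j) - X)).natDegree ≤ ee := by
      refine (natDegree_prod_le _ _).trans ((sum_le_sum fun j _ => hlin _).trans ?_); simp
    refine (natDegree_mul_le.trans (add_le_add (natDegree_mul_le.trans (add_le_add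
      ((natDegree_C_mul_le _ _).trans hy) hz)) he)).trans ?_
    omega
  · simp only [eval_mul, eval_C, eval_prod, eval_sub, eval_X, sub_zero]
    rcases Nat.eq_zero_or_pos y with hy0 | hy0
    · subst hy0
      simp only [range_zero, prod_empty, mul_one]
      refine mul_nonneg (mul_nonneg hκ0 (prod_nonneg fun j hj => ?_)) (prod_nonneg fun j hj => ?_)
      · have := mem_range.1 hj
        have : (2 : ℝ) * j ≤ t := by exact_mod_cast (by omega : 2 * j ≤ t)
        linarith
      · have := mem_range.1 hj
        have : (2 : ℝ) * j ≤ s := by exact_mod_cast (by omega : 2 * j ≤ s)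
        linarith
    · have : ∏ j ∈ range y, ((0 : ℝ) - (j : ℝ)) = 0 := prod_eq_zero (mem_range.2 hy0) (by simp)
      rw [this]; simp
  · intro a i i' hai hai'
    have evY : ((∏ j ∈ range y, (X - C (j : ℝ))).eval (a : ℝ)) = ∏ j ∈ range y, ((a : ℝ) - j) := by
      rw [eval_prod]; exact prod_congr rfl fun j _ => by simp
    have evZ : ((∏ j ∈ range z, (C ((t : ℝ) - 2 * j) - X)).eval (a : ℝ)) = 2 ^ z * ∏ j ∈ range z, ((i : ℝ) - j) := by
      rw [eval_prod]
      have ht' : (t : ℝ) = a + 2 * i := by exact_mod_cast hai.symm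
      rw [show (2 : ℝ) ^ z = ∏ _j ∈ range z, (2 : ℝ) by simp, ← prod_mul_distrib]
      exact prod_congr rfl fun j _ => by simp [ht']; ring
    have evE : ((∏ j ∈ range ee, (C ((s : ℝ) - 2 * j) - X)).eval (a : ℝ)) =
        2 ^ ee * ∏ j ∈ range ee, ((i' : ℝ) - j) := by
      rw [eval_prod]
      have hs' : (s : ℝ) = a + 2 * i' := by exact_mod_cast hai'.symm
      rw [show (2 : ℝ) ^ ee = ∏ _j ∈ range ee, (2 : ℝ) by simp, ← prod_mul_distrib]
      exact prod_congr rfl fun j _ => by simp [hs']; ring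
    rw [eval_mul, eval_mul, eval_mul, eval_C, evY, evZ, evE, hκ]
    -- the three descending factorials on the right, as real products (or zero)
    have hA : ((a.descFactorial y : ℕ) : ℝ) = ∏ j ∈ range y, ((a : ℝ) - j) := by
      by_cases hya : y ≤ a
      · exact cast_descFactorial_eq_prod hya
      · rw [Nat.descFactorial_eq_zero_iff_lt.2 (not_le.1 hya), Nat.cast_zero]
        exact (prod_eq_zero (mem_range.2 (not_le.1 hya)) (by simp)).symm
    have hB : ((i.descFactorial z : ℕ) : ℝ) = ∏ j ∈ range z, ((i : ℝ) - j) := by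
      by_cases hzi : z ≤ i
      · exact cast_descFactorial_eq_prod hzi
      · rw [Nat.descFactorial_eq_zero_iff_lt.2 (not_le.1 hzi), Nat.cast_zero]
        exact (prod_eq_zero (mem_range.2 (not_le.1 hzi)) (by simp)).symm
    have hC : ((i'.descFactorial ee : ℕ) : ℝ) = ∏ j ∈ range ee, ((i' : ℝ) - j) := by
      by_cases hei : ee ≤ i'
      · exact cast_descFactorial_eq_prod hei
      · rw [Nat.descFactorial_eq_zero_iff_lt.2 (not_le.1 hei), Nat.cast_zero]
        exact (prod_eq_zero (mem_range.2 (not_le.1 hei)) (by simp)).symm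
    push_cast
    rw [hA, hB, hC]
    field_simp

/-- There are at most `|A|` window edges in a matching: each contains a point of `A`, and two edges of a
matching sharing a point coincide. [folklore] -/
theorem card_filter_meets_le {S : Finset V} {M : Finset (Sym2 V)} (hM : IsPMOn S M) (A : Finset V) :
    (M.filter fun e => ∃ a ∈ A, a ∈ e).card ≤ A.card := by
  classical
  let f : V → Sym2 V := fun a => if h : ∃ e ∈ M, a ∈ e then h.choose else s(a, a)
  refine card_le_card_of_surjOn f fun e he => ?_
  rw [mem_coe, mem_filter] at he
  obtain ⟨heM, a, haA, hae⟩ := he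
  refine ⟨a, mem_coe.2 haA, ?_⟩
  have h : ∃ e ∈ M, a ∈ e := ⟨e, heM, hae⟩
  show (if h : ∃ e ∈ M, a ∈ e then h.choose else s(a, a)) = e
  rw [dif_pos h]
  exact hM.unique h.choose_spec.1 heM h.choose_spec.2 hae

/-- **Junta sum law, matching side** (cell (N1) Lemma 2, twin): for a cut `U ⊆ S` (`|U| = t`, `|S \ U| = s`),
a window `A ⊆ S` and a function `G` of perfect matchings of `S` depending only on
the window edges `M[A] = {e ∈ M : e meets A}` with nonnegative values `Λ`, the level sums
`Σ_{M : #cr(U,M) = a} G(M)` equal `#{M : #cr(U,M) = a} · P(a)` along `a + 2i = t`, `a + 2i' = s`, for one real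
polynomial `P` of degree `≤ |A|` with `P(0) ≥ 0`. [folklore] -/
theorem junta_sum_law_pm {S U : Finset V} (hU : U ⊆ S) {t s : ℕ} (hUc : U.card = t) (hSc : (S \ U).card = s)
    (A : Finset V) (hA : A ⊆ S) (G Λ : Finset (Sym2 V) → ℝ)
    (hG : ∀ M ∈ perfectMatchings S, G M = Λ (M.filter fun e => ∃ a ∈ A, a ∈ e)) (hΛ : ∀ E, 0 ≤ Λ E) :
    ∃ P : Polynomial ℝ, P.natDegree ≤ A.card ∧ 0 ≤ P.eval 0 ∧ ∀ a i i' : ℕ, a + 2 * i = t → a + 2 * i' = s →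
      ∑ M ∈ (perfectMatchings S).filter (fun M => (M.filter fun e => cutCount U e = 1).card = a), G M =
        ((((perfectMatchings S).filter fun M => (M.filter fun e => cutCount U e = 1).card = a).card : ℕ) : ℝ) *
          P.eval (a : ℝ) := by
  classical
  set T := (perfectMatchings S).image (fun M => M.filter fun e => ∃ a ∈ A, a ∈ e) with hT
  -- the pattern polynomial of each window edge set in the image
  have hP : ∀ E : Finset (Sym2 V), ∃ P : Polynomial ℝ, P.natDegree ≤ A.card ∧ 0 ≤ P.eval 0 ∧
      (E ∈ T → ∀ a i i' : ℕ, a + 2 * i = t → a + 2 * i' = s →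
        ((((perfectMatchings S).filter fun M =>
            E ⊆ M ∧ (M.filter fun e => cutCount U e = 1).card = a).card : ℕ) : ℝ) =
          ((((perfectMatchings S).filter fun M => (M.filter fun e => cutCount U e = 1).card = a).card : ℕ) : ℝ) *
            P.eval (a : ℝ)) := by
    intro E
    by_cases hET : E ∈ T
    · obtain ⟨M₀, hM₀, rfl⟩ := mem_image.1 hET
      rw [mem_perfectMatchings] at hM₀
      set E := M₀.filter (fun e => ∃ a ∈ A, a ∈ e) with hE
      have hEM : E ⊆ M₀ := filter_subset _ _
      have hWE : IsPMOn (S.filter fun v => ∃ e ∈ E, v ∈ e) E := isPMOn_verts hM₀ hEM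
      set W := S.filter (fun v => ∃ e ∈ E, v ∈ e) with hW
      have hWS : W ⊆ S := filter_subset _ _
      have hxA : E.card ≤ A.card := card_filter_meets_le hM₀ A
      set y := (E.filter fun e => cutCount U e = 1).card with hy
      set z := (E.filter fun e => cutCount U e = 2).card with hz
      have hyz : y + z ≤ E.card := by
        rw [hy, hz, ← card_union_of_disjoint (disjoint_filter.2 fun e _ h1 h2 => by omega)]
        exact card_le_card (union_subset (filter_subset _ _) (filter_subset _ _))
      have hUW : (U ∩ W).card = y + 2 * z := card_inter_verts_eq hWE
      have hWU := card_verts_sdiff_eq (U := U) hWE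
      have hle1 : y + 2 * z ≤ t := by rw [← hUW, ← hUc]; exact card_le_card inter_subset_left
      have hle2 : y + 2 * (E.card - y - z) ≤ s := by
        have : (W \ U).card ≤ (S \ U).card := card_le_card (sdiff_subset_sdiff hWS Subset.rfl)
        rw [hSc] at this; omega
      obtain ⟨P, hPdeg, hP0, hPval⟩ := pattern_poly_exists_pm t s (x := E.card) (y := y) (z := z)
        (ee := E.card - y - z) (by omega) hle1 hle2
      refine ⟨P, hPdeg.trans hxA, hP0, fun _ a i i' hai hai' => ?_⟩
      have hUc' : U.card = a + 2 * i := by rw [hUc, hai]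
      have hSc' : (S \ U).card = a + 2 * i' := by rw [hSc, hai']
      have hnat := card_pm_fiber_ratio_nat hU hWS hWE hUc' hSc'
      have hreal := hPval a i i' hai hai'
      have hD : (0 : ℝ) < ((t.descFactorial (y + 2 * z) : ℕ) : ℝ) * ((s.descFactorial (y + 2 * (E.card - y - z)) : ℕ) : ℝ) := by
        have h1 : t.descFactorial (y + 2 * z) ≠ 0 := fun h0 => by
          rw [Nat.descFactorial_eq_zero_iff_lt] at h0; omega
        have h2 : s.descFactorial (y + 2 * (E.card - y - z)) ≠ 0 := fun h0 => by
          rw [Nat.descFactorial_eq_zero_iff_lt] at h0; omega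
        positivity
      have hnatR := congrArg (fun m : ℕ => (m : ℝ)) hnat
      simp only [Nat.cast_mul] at hnatR
      rw [hai, hai'] at hnatR
      rw [hy, hz] at hreal hD
      -- fiber · D = total · Nnum and P(a) · D = Nnum
      refine mul_right_cancel₀ hD.ne' ?_
      rw [hnatR]
      push_cast at hreal ⊢
      rw [← hreal]
      ring
    · exact ⟨0, by simp, by simp, fun h => absurd h hET⟩
  choose P hPdeg hP0 hPval using hP
  refine ⟨∑ E ∈ T, C (Λ E) * P E, ?_, ?_, ?_⟩
  · exact natDegree_sum_le_of_forall_le _ _ fun E _ => (natDegree_C_mul_le _ _).trans (hPdeg E)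
  · rw [eval_finsetSum]
    exact sum_nonneg fun E _ => by rw [eval_mul, eval_C]; exact mul_nonneg (hΛ E) (hP0 E)
  · intro a i i' hai hai'
    have hmaps : ∀ M ∈ (perfectMatchings S).filter (fun M => (M.filter fun e => cutCount U e = 1).card = a),
        (M.filter fun e => ∃ a ∈ A, a ∈ e) ∈ T :=
      fun M hM => mem_image_of_mem _ (mem_filter.1 hM).1
    rw [← sum_fiberwise_of_maps_to hmaps, eval_finsetSum, mul_sum]
    refine sum_congr rfl fun E hE => ?_
    -- on the fibre `M[A] = E`, `G = Λ E`, and the fibre is `{M ⊇ E}`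
    obtain ⟨M₀, hM₀, hM₀E⟩ := mem_image.1 hE
    rw [mem_perfectMatchings] at hM₀
    have hkey : ∀ M : Finset (Sym2 V), IsPMOn S M →
        ((M.filter fun e => ∃ a ∈ A, a ∈ e) = E ↔ E ⊆ M) := by
      intro M hM
      constructor
      · intro h; rw [← h]; exact filter_subset _ _
      · intro hEM
        ext e
        simp only [mem_filter]
        constructor
        · rintro ⟨heM, a, haA, hae⟩
          -- `a` lies on an edge of `E`
          obtain ⟨e₀, he₀, hae₀⟩ := hM₀.exists_mem (hA haA)
          have he₀E : e₀ ∈ E := by rw [← hM₀E]; exact mem_filter.2 ⟨he₀, a, haA, hae₀⟩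
          have : e = e₀ := hM.unique heM (hEM he₀E) hae hae₀
          rw [this]; exact he₀E
        · intro heE
          refine ⟨hEM heE, ?_⟩
          have := heE; rw [← hM₀E] at this; exact (mem_filter.1 this).2
    have hconst : ∀ M ∈ ((perfectMatchings S).filter fun M => (M.filter fun e => cutCount U e = 1).card = a).filter
        (fun M => (M.filter fun e => ∃ a ∈ A, a ∈ e) = E), G M = Λ E := by
      intro M hM
      simp only [mem_filter] at hM
      rw [hG M hM.1.1, hM.2]
    rw [sum_congr rfl hconst, sum_const, nsmul_eq_mul, filter_filter]
    have hset : ((perfectMatchings S).filter fun M =>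
          (M.filter fun e => cutCount U e = 1).card = a ∧ (M.filter fun e => ∃ a ∈ A, a ∈ e) = E) =
        (perfectMatchings S).filter fun M => E ⊆ M ∧ (M.filter fun e => cutCount U e = 1).card = a := by
      refine filter_congr fun M hM => ?_
      rw [mem_perfectMatchings] at hM
      rw [hkey M hM]; exact and_comm
    rw [hset, hPval E hE a i i' hai hai', eval_mul, eval_C]
    ring

end MatchingLaw

end Summit.PneNP.PneNP.Theorems.ChebyshevTracialDesignJunta
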